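import Summits.Ventures.HSemireg.Pad4TowerLinePhaseRigidityGap

/-!
# Pad4Tower ∕ LinePhaseRigidity — Part G the first PHASE-SENSITIVE ceiling law (h-uniform, PROVED): TAG UNIQUENESS at a rigid letter and the PAIR-TYPE gap `g_P ≥ 4`
# (HSemireg support file; PT-PORT-2 (a3), tree copy of control's crux workfile)

Crux of record: `Summit.HodgeConjecture.HodgeConjecture.Theses.EightfoldBlochSeeds.BlochSeedDiscOne` (= `HasHyperbolicBlochSeed 4 1`, item
stmt-HodgeConjecture-18881; skeleton `Cruxes/BlochSeedDiscOne/Lines/birth.lean` 814a6a70c14e831a, STUB R `stub_rung_pad4_seedAt`, UNTOUCHED).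
Nothing in this file proves HC, HC_AV, HC_CM, H2, item 18881, (T₈) or (T₁₀); census-neutral (no SAT∕UNSAT row is added or changed). Statements about
the typed FIRST-ORDER static game on the LINE alphabet of the PAD-4 design tower (`RuleDMu4Closed`, `XPlusClosed`, `G1Closed` of record) — H₁-static
letter DESIGNS, not sheaves, monads or seeds; HC_CM is a displayed binder of the ladder only, unused here.

PROVENANCE. TREE COPY — statements AND proofs verbatim; new are only the namespace `Summit.Ventures.HSemireg.Pad4Tower.LinePhaseRigidity`, this module docstring, the module boundary, the
`open` of the tree toolkit namespace `…Pad4Tower.LineInertia` (= the workfile's Part A), one-line docstrings where the gate requires them, and ONE dedup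
to the tree the key allows: Part J's `fin4_add_two_ne : ∀ k : Fin 4, k + 2 ≠ k` is NOT re-declared — its uses call the toolkit's identical `LineInertia.add_two_ne` —
of Part G of the crux workfile `Cruxes/BlochSeedDiscOne/LinePhaseRigidity.lean` v1.9 (author plan-lens-HodgeAV-control g9; crux commit f5c30e1c3066, sha16 f0ad6d2122a71d9c; critic plates idea-crit-6 g15 PASS). Filed in the tree on plan-lens-HodgeAV-control g10's KEY (a3) (bus l.10147: «Parts G–L up to `oddFCFreeLine_of_lt_twelve`,
`not_oddFCFreeLine_twelve`, `fcShapeLine_of_lt_twelve` → tree, so that `DiamondLevelLaws.OddLineFree h` (∀ h < 12) is a tree theorem and the displayed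
hypothesis of `oddThreshold_iff_lineNest` is discharged by name») by hsemireg-phasetorus-typer-1 g3. Module set of (a3), each importing the previous, on top of
(a2)'s `Pad4TowerLinePhaseRigidityGap`: `Pad4TowerLinePhaseRigidityTags` (Part G) → `…Parity` (Parts H, I) → `…Nucleus1` (Part J, first half) → `…Nucleus2` (Part J, second half: `oddFCFreeLine_of_lt_twelve`, `oddLineThresholdLaw_holds`) → `…PhaseType` (Part K) → `…Shape` (Part L: `fcShapeLine_of_lt_twelve`). 0 sorry, 0 named facts, no instance ∕ notation ∕ set_option ∕ native_decide; docstring on every declaration.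

CONTENT. In `namespace LineModel`: tag uniqueness at a rigid letter (`X+` with both lower-server conditions vacuous) and the pair-type ceiling gap; the top-level corollaries of Part G.
-/

namespace Summit.Ventures.HSemireg.Pad4Tower.LinePhaseRigidity

open Finset Summit.Ventures.HSemireg.Pad4Tower Summit.Ventures.HSemireg.LinePhaseTorus Summit.Ventures.HSemireg.Pad4Tower.LineInertia

/-! ## Part G — the first PHASE-SENSITIVE ceiling law (h-uniform, PROVED): TAG UNIQUENESS at a rigid letter and the PAIR-TYPE gap `g_P ≥ 4`

A letter `(c,k)@g` of a `P`-cell is RIGID when `2(c+2) > h`: by (E1′) no `N`-cell contains it together with another charged letter, so the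
`X+` rule sees a bare hub and no companions.  Consequence (`tag_unique`): all `P`-cells `X[b ≔ (d,p)]` completing a rigid frame at one
slot `b` carry THE SAME tag `p`.  Feeding RD-P∕RD-N2 through it (with one slot swap) gives `p3_tags`: in a `P`-cell with three charged
slots whose top letter has `2(c+3) > h` the two lower letters have EQUAL tags; `n3_tags`: the same on `N` for a top letter with
`2(c+4) > h`; hence **`fcP_three_tags`: in a fully charged `P`-cell, next to a letter with `2(c+4) > h` the other three tags are equal**,
and `fcN_three_tags` (`2(c+5) > h`).  Contrapositive = the machine's pair-type refinement: an FC cell whose tag word is not of the form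
`t t t ∗` around the tall letter keeps FOUR levels below the ceiling on `P` (`2(c+4) ≤ h`), FIVE on `N` — `g_P(T) ≥ 4`, `g_N(T) ≥ 5` for
T ∈ {0011, 0022, 0012, 0013, 0023, 0123} (equality for the five pair types by `TGRID-G1-*.txt`; `0123` needs 6 — not proved here). -/

/-- `fin4_cover` (Part G; tree copy, statement verbatim). -/
theorem fin4_cover {g a b f : Fin 4} (hga : g ≠ a) (hgb : g ≠ b) (hgf : g ≠ f) (hab : a ≠ b) (haf : a ≠ f) (hbf : b ≠ f)
    (i : Fin 4) : i = g ∨ i = a ∨ i = b ∨ i = f := by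
  revert g a b f i; decide

/-- `fin4_fourth` (Part G; tree copy, statement verbatim). -/
theorem fin4_fourth {g a b : Fin 4} (hga : g ≠ a) (hgb : g ≠ b) (hab : a ≠ b) : ∃ f : Fin 4, g ≠ f ∧ a ≠ f ∧ b ≠ f := by
  revert g a b; decide

namespace LineModel

variable {h : ℤ} {vN vP : ACell → Prop}

/-- **TAG UNIQUENESS at a rigid letter (PROVED).** If `(X g)` is charged with `2((X g).1 + 2) > h` and `f` is an apex slot, then two
`P`-cells `X[b ≔ (d,p)]`, `X[b ≔ (e,q)]` (`d, e ≥ 1`) have `p = q`: the hub `X[b ≔ apex]` is present (RD-P; a charged landing is (E1′)-dead),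
no `N`-companion exists on either ray ((E1′) again), so `X+` forbids two tags. -/
theorem tag_unique (M : LineModel h vN vP) {X : ACell} {g b f : Fin 4} (hgb : g ≠ b) (hfb : f ≠ b)
    (hg : 1 ≤ (X g).1) (hrig : h < 2 * ((X g).1 : ℤ) + 4) (hf : (X f).1 = 0) {d e : ℕ} {p q : Fin 4} (hd : 1 ≤ d) (he : 1 ≤ e)
    (hp : vP (Function.update X b (d, p))) (hq : vP (Function.update X b (e, q))) : p = q := by
  by_contra hpq
  have hnoN : ∀ (c' : ℕ) (r : Fin 4), 1 ≤ c' → ¬ vN (Function.update X b (c', r)) := by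
    intro c' r hc' hv
    have e1 : Function.update X b (c', r) g = X g := Function.update_of_ne hgb _ _
    have e2 : Function.update X b (c', r) b = (c', r) := Function.update_self _ _ _
    have key := M.n2_gap_two hv (g := g) (j := b) hgb (by rw [e1]; exact hg) (by rw [e2]; exact hc')
    rw [e1] at key
    linarith
  have eb : Function.update X b (d, p) b = (d, p) := Function.update_self _ _ _
  have ef : Function.update X b (d, p) f = X f := Function.update_of_ne hfb _ _
  -- the hub
  have hub : vN (Function.update X b (0, 0)) := by
    obtain ⟨c', hc', hN⟩ := M.rdP _ hp b (by rw [eb]; exact hd)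
    rw [eb, Function.update_idem] at hN
    rcases Nat.eq_zero_or_pos c' with rfl | hpos
    · have := M.apexN _ hN b 0 (by rw [Function.update_self])
      rwa [Function.update_idem] at this
    · exact absurd hN (hnoN c' p hpos)
  refine M.xplus (Function.update X b (d, p)) hp b f hfb (by rw [eb]; exact hd) (by rw [ef]; exact hf) ?_ ?_ e q
    (by rw [eb]; exact fun h' => hpq h'.symm) he ?_ ?_
  · rw [Function.update_idem]; exact hub
  · intro c' hc' _
    rw [eb, Function.update_idem]
    exact hnoN c' p hc'
  · rw [Function.update_idem]; exact hq
  · intro e' he' _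
    rw [Function.update_idem]
    exact hnoN e' q he'

/-- **(P3T) in a `P`-cell with three charged slots `g, a, b` and apex `f`, if the `g`-letter has `2(c+3) > h` then the `a`- and `b`-letters
carry EQUAL tags (PROVED).**  RD-P at `a` (resp. `b`) must land on the apex ((E3′)), RD-N2 then raises `g` by exactly one level (a ceiling
letter is (PC)-dead) — two `P`-cells with the rigid letter `(c+1,k)@g` and one charged slot; after swapping `a ↔ b` in the second they
complete the same rigid frame at `b` with tags `k_b` and `k_a`, so `tag_unique` gives `k_a = k_b`. -/
theorem p3_tags (M : LineModel h vN vP) {Z : ACell} {g a b f : Fin 4} (hga : g ≠ a) (hgb : g ≠ b) (hgf : g ≠ f) (hab : a ≠ b)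
    (haf : a ≠ f) (hbf : b ≠ f) (hZ : vP Z) (hg : 1 ≤ (Z g).1) (htop : h < 2 * ((Z g).1 : ℤ) + 6) (ha : 1 ≤ (Z a).1)
    (hb : 1 ≤ (Z b).1) (hf : (Z f).1 = 0) : (Z a).2 = (Z b).2 := by
  -- RD-P at a charged lower slot lands on the apex
  have drop : ∀ {x y : Fin 4}, g ≠ x → g ≠ y → x ≠ y → 1 ≤ (Z x).1 → 1 ≤ (Z y).1 → vN (Function.update Z x (0, 0)) := by
    intro x y hgx hgy hxy hx hy
    obtain ⟨c', hc', hN⟩ := M.rdP Z hZ x hx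
    rcases Nat.eq_zero_or_pos c' with rfl | hpos
    · have := M.apexN _ hN x 0 (by rw [Function.update_self])
      rwa [Function.update_idem] at this
    · exfalso
      have eg : Function.update Z x (c', (Z x).2) g = Z g := Function.update_of_ne hgx _ _
      have ex : Function.update Z x (c', (Z x).2) x = (c', (Z x).2) := Function.update_self _ _ _
      have ey : Function.update Z x (c', (Z x).2) y = Z y := Function.update_of_ne hxy.symm _ _
      have key := M.n3_gap_three hN (g := g) (a := x) (b := y) hgx hgy hxy (by rw [eg]; exact hg) (by rw [ex]; exact hpos)
        (by rw [ey]; exact hy)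
      rw [eg] at key
      linarith
  -- RD-N2 then raises `g` by exactly one level
  have raise : ∀ {x y : Fin 4}, g ≠ x → g ≠ y → x ≠ y → 1 ≤ (Z y).1 → vN (Function.update Z x (0, 0)) →
      vP (Function.update (Function.update Z x (0, 0)) g ((Z g).1 + 1, (Z g).2)) := by
    intro x y hgx hgy hxy hy hW
    have eg : Function.update Z x ((0 : ℕ), (0 : Fin 4)) g = Z g := Function.update_of_ne hgx _ _
    have ey : Function.update Z x ((0 : ℕ), (0 : Fin 4)) y = Z y := Function.update_of_ne hxy.symm _ _
    obtain ⟨c', hc', hch, hP⟩ := M.rdN2 _ hW g y hgy (by rw [eg]; exact hg) (by rw [ey]; exact hy)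
    rw [eg] at hc' hP
    have hc'eq : c' = (Z g).1 + 1 := by
      by_contra hne
      have h2 : (Z g).1 + 2 ≤ c' := by omega
      have e1 : Function.update (Function.update Z x ((0 : ℕ), (0 : Fin 4))) g (c', (Z g).2) g = (c', (Z g).2) :=
        Function.update_self _ _ _
      have e2 : Function.update (Function.update Z x ((0 : ℕ), (0 : Fin 4))) g (c', (Z g).2) y = Z y := by
        rw [Function.update_of_ne hgy.symm, ey]
      refine M.p_ceiling_absent hP (g := g) (b := y) hgy (by rw [e1]; omega) (by rw [e2]; exact hy) ?_
      rw [e1]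
      have : ((Z g).1 : ℤ) + 2 ≤ c' := by exact_mod_cast h2
      push_cast
      linarith
    rw [hc'eq] at hP
    exact hP
  have hWa := drop hga hgb hab ha hb
  have hWb := drop hgb hga hab.symm hb ha
  have hUb := raise hga hgb hab hb hWa      -- g raised, a apex, b charged
  have hUa := raise hgb hga hab.symm ha hWb -- g raised, b apex, a charged
  have hUa' := M.permP _ hUa (Equiv.swap a b)
  -- common rigid frame
  set B : ACell := Function.update (Function.update (Function.update Z a ((0 : ℕ), (0 : Fin 4))) b ((0 : ℕ), (0 : Fin 4))) g
    ((Z g).1 + 1, (Z g).2) with hB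
  have cov := fin4_cover hga hgb hgf hab haf hbf
  have e1 : Function.update B b (Z b) = Function.update (Function.update Z a ((0 : ℕ), (0 : Fin 4))) g ((Z g).1 + 1, (Z g).2) := by
    funext i
    rcases cov i with rfl | rfl | rfl | rfl <;>
      simp [hB, hgb, hab, hga.symm, hgb.symm, hab.symm, haf.symm, hbf.symm, hgf.symm]
  have e2 : Function.update B b (Z a) =
      fun i => Function.update (Function.update Z b ((0 : ℕ), (0 : Fin 4))) g ((Z g).1 + 1, (Z g).2) (Equiv.swap a b i) := by
    funext i
    rcases cov i with rfl | rfl | rfl | rfl <;>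
      simp [hB, Equiv.swap_apply_def, hga, hgb, hab, hga.symm, hgb.symm, haf.symm, hbf.symm, hgf.symm]
  have hBg : B g = ((Z g).1 + 1, (Z g).2) := by simp [hB]
  have hBf : (B f).1 = 0 := by
    simp [hB, hgf.symm, hbf.symm, haf.symm, hf]
  have key := M.tag_unique (X := B) (g := g) (b := b) (f := f) hgb hbf.symm (by rw [hBg]; omega)
    (by rw [hBg]; push_cast; linarith) hBf (d := (Z b).1) (e := (Z a).1) (p := (Z b).2) (q := (Z a).2) hb ha
    (by rw [show ((Z b).1, (Z b).2) = Z b from rfl, e1]; exact hUb)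
    (by rw [show ((Z a).1, (Z a).2) = Z a from rfl, e2]; exact hUa')
  exact key.symm

/-- **(N3T)** the same on `N` one level lower: three charged slots, top letter with `2(c+4) > h` ⇒ the two lower tags are equal. -/
theorem n3_tags (M : LineModel h vN vP) {Y : ACell} {g a b f : Fin 4} (hga : g ≠ a) (hgb : g ≠ b) (hgf : g ≠ f) (hab : a ≠ b)
    (haf : a ≠ f) (hbf : b ≠ f) (hY : vN Y) (hg : 1 ≤ (Y g).1) (htop : h < 2 * ((Y g).1 : ℤ) + 8) (ha : 1 ≤ (Y a).1)
    (hb : 1 ≤ (Y b).1) (hf : (Y f).1 = 0) : (Y a).2 = (Y b).2 := by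
  obtain ⟨c', hc', -, hP⟩ := M.rdN2 Y hY g a hga hg ha
  have eg : Function.update Y g (c', (Y g).2) g = (c', (Y g).2) := Function.update_self _ _ _
  have ea : Function.update Y g (c', (Y g).2) a = Y a := Function.update_of_ne hga.symm _ _
  have eb : Function.update Y g (c', (Y g).2) b = Y b := Function.update_of_ne hgb.symm _ _
  have ef : Function.update Y g (c', (Y g).2) f = Y f := Function.update_of_ne hgf.symm _ _
  have : ((Y g).1 : ℤ) + 1 ≤ c' := by exact_mod_cast hc'
  have key := M.p3_tags hga hgb hgf hab haf hbf hP (by rw [eg]; omega) (by rw [eg]; push_cast; linarith)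
    (by rw [ea]; exact ha) (by rw [eb]; exact hb) (by rw [ef]; exact hf)
  rwa [ea, eb] at key

/-- **THREE-EQUAL-TAGS LAW on `P` (PROVED, h-uniform): in a fully charged `P`-cell, the three letters other than a letter with
`2(c+4) > h` carry one and the same tag.** -/
theorem fcP_three_tags (M : LineModel h vN vP) {X : ACell} (hX : vP X) (hc : ∀ f, 1 ≤ (X f).1) {g a b : Fin 4} (hga : g ≠ a)
    (hgb : g ≠ b) (hab : a ≠ b) (htop : h < 2 * ((X g).1 : ℤ) + 8) : (X a).2 = (X b).2 := by
  obtain ⟨f, hgf, haf, hbf⟩ := fin4_fourth hga hgb hab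
  obtain ⟨c', hc', hN⟩ := M.rdP X hX f (hc f)
  rcases Nat.eq_zero_or_pos c' with rfl | hpos
  · have eg : Function.update X f ((0 : ℕ), (X f).2) g = X g := Function.update_of_ne hgf _ _
    have ea : Function.update X f ((0 : ℕ), (X f).2) a = X a := Function.update_of_ne haf _ _
    have eb : Function.update X f ((0 : ℕ), (X f).2) b = X b := Function.update_of_ne hbf _ _
    have key := M.n3_tags hga hgb hgf hab haf hbf hN (by rw [eg]; exact hc g) (by rw [eg]; exact htop) (by rw [ea]; exact hc a)
      (by rw [eb]; exact hc b) (by rw [Function.update_self])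
    rwa [ea, eb] at key
  · exfalso
    have hcZ : ∀ i, 1 ≤ (Function.update X f (c', (X f).2) i).1 := by
      intro i
      by_cases hi : i = f
      · subst hi; rw [Function.update_self]; exact hpos
      · rw [Function.update_of_ne hi]; exact hc i
    have key := M.fcN_gap_four hN hcZ g
    rw [Function.update_of_ne hgf] at key
    linarith

/-- **THREE-EQUAL-TAGS LAW on `N`** (PROVED): the same next to a letter with `2(c+5) > h`. -/
theorem fcN_three_tags (M : LineModel h vN vP) {X : ACell} (hX : vN X) (hc : ∀ f, 1 ≤ (X f).1) {g a b : Fin 4} (hga : g ≠ a)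
    (hgb : g ≠ b) (hab : a ≠ b) (htop : h < 2 * ((X g).1 : ℤ) + 10) : (X a).2 = (X b).2 := by
  obtain ⟨c', hc', -, hP⟩ := M.rdN2 X hX g a hga (hc g) (hc a)
  have hcZ : ∀ i, 1 ≤ (Function.update X g (c', (X g).2) i).1 := by
    intro i
    by_cases hi : i = g
    · subst hi; rw [Function.update_self]; exact le_of_lt (lt_of_le_of_lt (hc i) hc')
    · rw [Function.update_of_ne hi]; exact hc i
  have : ((X g).1 : ℤ) + 1 ≤ c' := by exact_mod_cast hc'
  have key := M.fcP_three_tags hP hcZ hga hgb hab (by rw [Function.update_self]; push_cast; linarith)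
  rwa [Function.update_of_ne hga.symm, Function.update_of_ne hgb.symm] at key

end LineModel

/-- **THE PAIR-TYPE CEILING GAP on `P` (PROVED, every `h`)**: if a fully charged RULE-D `P`-cell of a `G₁`-closed RULE-D∕`X+` LINE design
carries, besides the letter `lineLetter h c k` at `g`, two letters with DIFFERENT tags, then `2(c+4) ≤ h` — one level more than the
phase-blind `2(c+3) ≤ h` of Part F; this is the machine's `g_P(T) = 4` for the pair types `0011, 0022, 0012, 0013, 0023` (and a first
bound for `0123`). -/
theorem fc_pair_gap_P {h : ℤ} {C : MConfig} (hC : LSupport h C) (hG : C.G1Closed) (hD : RuleDMu4Closed C) (hX : XPlusClosed C)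
    {P : MCell} (hP : P ∈ C.upper) (hFC : FCc P) {g a b : Fin 4} (hga : g ≠ a) (hgb : g ≠ b) (hab : a ≠ b) {c ca cb : ℕ}
    {k ka kb : Fin 4} (eg : P g = lineLetter h c k) (ea : P a = lineLetter h ca ka) (eb : P b = lineLetter h cb kb)
    (hk : ka ≠ kb) : 2 * (c : ℤ) + 8 ≤ h := by
  have hM := lineModel_of_config hC hG hD hX
  obtain ⟨X, rfl⟩ := exists_realize (fun f => hC.2 _ hP f)
  have hc := charges_pos_of_fcc hFC
  rw [realize_apply] at eg ea eb
  obtain ⟨-, rfl⟩ := lineLetter_inj (hc a) ea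
  obtain ⟨-, rfl⟩ := lineLetter_inj (hc b) eb
  rw [← charge_eq_of_lineLetter_eq eg]
  by_contra hlt
  exact hk (hM.fcP_three_tags hP hc hga hgb hab (by push Not at hlt; exact hlt))

/-- **THE PAIR-TYPE CEILING GAP on `N`** (PROVED, every `h`): `2(c+5) ≤ h` — the machine's `g_N(T) = 5` for the pair types. -/
theorem fc_pair_gap_N {h : ℤ} {C : MConfig} (hC : LSupport h C) (hG : C.G1Closed) (hD : RuleDMu4Closed C) (hX : XPlusClosed C)
    {N : MCell} (hN : N ∈ C.lower) (hFC : FCc N) {g a b : Fin 4} (hga : g ≠ a) (hgb : g ≠ b) (hab : a ≠ b) {c ca cb : ℕ}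
    {k ka kb : Fin 4} (eg : N g = lineLetter h c k) (ea : N a = lineLetter h ca ka) (eb : N b = lineLetter h cb kb)
    (hk : ka ≠ kb) : 2 * (c : ℤ) + 10 ≤ h := by
  have hM := lineModel_of_config hC hG hD hX
  obtain ⟨X, rfl⟩ := exists_realize (fun f => hC.1 _ hN f)
  have hc := charges_pos_of_fcc hFC
  rw [realize_apply] at eg ea eb
  obtain ⟨-, rfl⟩ := lineLetter_inj (hc a) ea
  obtain ⟨-, rfl⟩ := lineLetter_inj (hc b) eb
  rw [← charge_eq_of_lineLetter_eq eg]
  by_contra hlt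
  exact hk (hM.fcN_three_tags hN hc hga hgb hab (by push Not at hlt; exact hlt))

end Summit.Ventures.HSemireg.Pad4Tower.LinePhaseRigidity
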